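import Mathlib
import HarnessLib
import Literature.Combinatorics.Enumerative.PermPrescribed

/-!
# The random-order average in the entropy proof of Brégman's theorem

Topic `Literature/Combinatorics/Enumerative`.  In Radhakrishnan's entropy proof of Brégman's
theorem [Radhakrishnan1997] (and in Cuckler–Kahn's sharpening, "`-1` nat per vertex"
[CucklerKahn2009]) the rows `i' : Fin n` are revealed in a uniformly random *order*: a permutation
`ρ` of `Fin n`, row `i'` being revealed at time `ρ i'`.  For a probability vector `w` on `Fin n`
(the marginal of a fixed row `i`, `w i > 0`) the quantity `∑_{i' : ρ i ≤ ρ i'} w i'` is the mass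
*still available* to row `i` when it is revealed.  The main result `sum_perm_log_avail_le`
(and its restatement `sum_perm_log_avail_symm_le` through `τ = ρ⁻¹`, `τ k` = the row revealed at
time `k`) bounds the average of its logarithm over all `n!` orders:

  `∑_ρ log (∑_{i' : ρ i ≤ ρ i'} w i') ≤ (n-1)! · ∑_{k < n} log (w i + (1 - w i) · k/(n-1))`.

Proof: group the orders by the time `p = ρ i` (`(n-1)!` orders each, `card_filter_perm_apply_eq`);
inside a group Jensen's inequality for the concave `log` (`sum_log_le_card_mul_log_div`) bounds
the sum by `(n-1)! · log (average)`, and the average of the available mass is *exactly*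
`w i + (1 - w i)(n-1-p)/(n-1)` (`sum_filter_perm_apply_eq_sum_avail`), because a row `i' ≠ i`
is revealed after time `p` in exactly `(n-1-p)·(n-2)!` of these orders
(`card_filter_perm_apply_eq_and_le`, from `card_permsPrescribed`).  Reindex `k = n-1-p`.

## References

* [Radhakrishnan1997] J. Radhakrishnan, An entropy proof of Bregman's theorem, *J. Combin.
  Theory Ser. A* 77 (1997) 161–164, proof of Theorem 1.
* [CucklerKahn2009] B. Cuckler, J. Kahn, Entropy bounds for perfect matchings and Hamiltonian
  cycles, *Combinatorica* 29 (2009) 327–335.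
-/

namespace Literature.Combinatorics.Enumerative

open Finset

/-! ### Jensen's inequality for `log` with uniform weights -/

/-- Jensen for the concave `log`, uniform weights, via `log x ≤ x - 1`: for positive reals
`y k`, `k ∈ t`, `∑_{k ∈ t} log (y k) ≤ #t · log ((∑_{k ∈ t} y k) / #t)`. [folklore] -/
theorem sum_log_le_card_mul_log_div {κ : Type*} (t : Finset κ) (y : κ → ℝ)
    (hy : ∀ k ∈ t, 0 < y k) :
    ∑ k ∈ t, Real.log (y k) ≤ (t.card : ℝ) * Real.log ((∑ k ∈ t, y k) / t.card) := by
  rcases t.eq_empty_or_nonempty with rfl | ht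
  · simp
  set A := ∑ k ∈ t, y k with hA
  have hApos : 0 < A := Finset.sum_pos hy ht
  have hc : (0 : ℝ) < t.card := by exact_mod_cast ht.card_pos
  have key : ∀ k ∈ t, Real.log (y k) - Real.log (A / t.card) ≤ y k * t.card / A - 1 := by
    intro k hk
    have hyk := hy k hk
    rw [← Real.log_div hyk.ne' (div_pos hApos hc).ne', div_div_eq_mul_div]
    exact Real.log_le_sub_one_of_pos (by positivity)
  have hsum := Finset.sum_le_sum key
  have lhs : ∑ k ∈ t, (Real.log (y k) - Real.log (A / t.card)) =
      ∑ k ∈ t, Real.log (y k) - t.card * Real.log (A / t.card) := by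
    rw [Finset.sum_sub_distrib, Finset.sum_const, nsmul_eq_mul]
  have rhs : ∑ k ∈ t, (y k * t.card / A - 1) = 0 := by
    rw [Finset.sum_sub_distrib, Finset.sum_const, nsmul_eq_mul, mul_one, ← Finset.sum_div,
      ← Finset.sum_mul, ← hA]
    field_simp
    ring
  rw [lhs, rhs] at hsum
  linarith

/-! ### Counting orders -/

section Counting

variable {α : Type*} [Fintype α] [DecidableEq α]

/-- The permutations of a finite type with `n` elements taking a prescribed value at one point
number `(n-1)!`. [folklore] -/
theorem card_filter_perm_apply_eq (i p : α) :
    (Finset.univ.filter fun ρ : Equiv.Perm α => ρ i = p).card =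
      (Fintype.card α - 1).factorial := by
  have hS : (Finset.univ.filter fun ρ : Equiv.Perm α => ρ i = p) =
      permsPrescribed {i} (fun _ => p) := by
    ext ρ
    simp [mem_permsPrescribed]
  have hinj : Set.InjOn (fun _ : α => p) (↑({i} : Finset α)) := by
    rw [Finset.coe_singleton]
    exact Set.injOn_singleton _ _
  rw [hS, card_permsPrescribed _ hinj, Finset.card_singleton]

/-- The permutations of a finite type with `n` elements taking two distinct prescribed values at
two distinct points number `(n-2)!`. [folklore] -/
theorem card_filter_perm_apply_eq_apply_eq {i i' p q : α} (hi : i ≠ i') (hpq : p ≠ q) :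
    (Finset.univ.filter fun ρ : Equiv.Perm α => ρ i = p ∧ ρ i' = q).card =
      (Fintype.card α - 2).factorial := by
  have hS : (Finset.univ.filter fun ρ : Equiv.Perm α => ρ i = p ∧ ρ i' = q) =
      permsPrescribed {i, i'} (fun x => if x = i then p else q) := by
    ext ρ
    simp [mem_permsPrescribed, hi.symm]
  have hinj : Set.InjOn (fun x => if x = i then p else q) (↑({i, i'} : Finset α)) := by
    intro x hx y hy hxy
    rw [Finset.coe_insert, Finset.coe_singleton] at hx hy
    rcases hx with rfl | rfl <;> rcases hy with rfl | rfl
    · rfl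
    · simp [hi.symm, hpq] at hxy
    · simp [hi.symm, hpq.symm] at hxy
    · rfl
  rw [hS, card_permsPrescribed _ hinj, Finset.card_pair hi]

end Counting

/-- Orders of `Fin n` in which row `i` is revealed at time `p` and a fixed other row `i'` not
earlier: there are `(n-1-p)·(n-2)!` of them (`n-1-p` admissible times for `i'`, then `(n-2)!`
completions). [folklore] -/
theorem card_filter_perm_apply_eq_and_le {n : ℕ} {i i' : Fin n} (hi : i ≠ i') (p : Fin n) :
    (Finset.univ.filter fun ρ : Equiv.Perm (Fin n) => ρ i = p ∧ ρ i ≤ ρ i').card =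
      (n - 1 - (p : ℕ)) * (n - 2).factorial := by
  set U := Finset.univ.filter fun ρ : Equiv.Perm (Fin n) => ρ i = p ∧ ρ i ≤ ρ i' with hU
  have hmaps : (U : Set (Equiv.Perm (Fin n))).MapsTo (fun ρ => ρ i') (Finset.Ioi p) := by
    intro ρ hρ
    obtain ⟨-, hρi, hle⟩ := Finset.mem_filter.1 (Finset.mem_coe.1 hρ)
    rw [Finset.coe_Ioi, Set.mem_Ioi, ← hρi]
    exact lt_of_le_of_ne hle fun h => hi (ρ.injective h)
  rw [Finset.card_eq_sum_card_fiberwise hmaps]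
  have hfib : ∀ q ∈ Finset.Ioi p, (U.filter fun ρ => ρ i' = q).card = (n - 2).factorial := by
    intro q hq
    have hpq : p < q := Finset.mem_Ioi.1 hq
    have hUq : (U.filter fun ρ => ρ i' = q) =
        Finset.univ.filter fun ρ : Equiv.Perm (Fin n) => ρ i = p ∧ ρ i' = q := by
      ext ρ
      simp only [hU, Finset.mem_filter, Finset.mem_univ, true_and]
      constructor
      · rintro ⟨⟨h1, -⟩, h2⟩
        exact ⟨h1, h2⟩
      · rintro ⟨h1, h2⟩
        exact ⟨⟨h1, by rw [h1, h2]; exact hpq.le⟩, h2⟩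
    rw [hUq, card_filter_perm_apply_eq_apply_eq hi hpq.ne, Fintype.card_fin]
  rw [Finset.sum_congr rfl hfib, Finset.sum_const, smul_eq_mul, Fin.card_Ioi]

/-- The total available mass over the orders revealing row `i` at time `p`:
`∑_{ρ : ρ i = p} ∑_{i' : ρ i ≤ ρ i'} w i' = w i · (n-1)! + (∑_{i' ≠ i} w i') · (n-1-p)(n-2)!`.
[folklore] -/
theorem sum_filter_perm_apply_eq_sum_avail {n : ℕ} (w : Fin n → ℝ) (i p : Fin n) :
    ∑ ρ ∈ Finset.univ.filter (fun ρ : Equiv.Perm (Fin n) => ρ i = p),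
        ∑ i' ∈ Finset.univ.filter (fun i' => ρ i ≤ ρ i'), w i' =
      w i * ((n - 1).factorial : ℝ) +
        (∑ i' ∈ Finset.univ.erase i, w i') * (((n - 1 - (p : ℕ)) * (n - 2).factorial : ℕ) : ℝ) := by
  have h1 : ∀ ρ ∈ Finset.univ.filter (fun ρ : Equiv.Perm (Fin n) => ρ i = p),
      ∑ i' ∈ Finset.univ.filter (fun i' => ρ i ≤ ρ i'), w i' =
        ∑ i', if ρ i ≤ ρ i' then w i' else 0 :=
    fun ρ _ => Finset.sum_filter _ _
  rw [Finset.sum_congr rfl h1, Finset.sum_comm]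
  have h2 : ∀ i' : Fin n,
      ∑ ρ ∈ Finset.univ.filter (fun ρ : Equiv.Perm (Fin n) => ρ i = p),
          (if ρ i ≤ ρ i' then w i' else 0) =
        w i' * ((Finset.univ.filter
          fun ρ : Equiv.Perm (Fin n) => ρ i = p ∧ ρ i ≤ ρ i').card : ℝ) := by
    intro i'
    rw [← Finset.sum_filter, Finset.filter_filter, Finset.sum_const, nsmul_eq_mul, mul_comm]
  rw [Finset.sum_congr rfl fun i' _ => h2 i', ← Finset.add_sum_erase _ _ (Finset.mem_univ i)]
  congr 1
  · have hii : (Finset.univ.filter fun ρ : Equiv.Perm (Fin n) => ρ i = p ∧ ρ i ≤ ρ i) =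
        Finset.univ.filter fun ρ : Equiv.Perm (Fin n) => ρ i = p := by
      ext ρ
      simp
    rw [hii, card_filter_perm_apply_eq, Fintype.card_fin]
  · rw [Finset.sum_mul]
    refine Finset.sum_congr rfl fun i' hi' => ?_
    rw [card_filter_perm_apply_eq_and_le (Finset.ne_of_mem_erase hi').symm p]

/-- The factorial bookkeeping `(n-1-p)·(n-2)!/(n-1)! = (n-1-p)/(n-1)` for `p < n` (both sides
vanish for `n = 1`). [folklore] -/
theorem cast_mul_factorial_div_factorial {n p : ℕ} (hp : p < n) :
    ((((n - 1 - p) * (n - 2).factorial : ℕ)) : ℝ) / ((n - 1).factorial : ℝ) =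
      ((n - 1 - p : ℕ) : ℝ) / ((n : ℝ) - 1) := by
  rcases Nat.lt_or_ge n 2 with hn | hn
  · have hn1 : n = 1 := by omega
    subst hn1
    have hp0 : p = 0 := by omega
    subst hp0
    simp
  · obtain ⟨m, rfl⟩ : ∃ m, n = m + 2 := ⟨n - 2, by omega⟩
    have e1 : m + 2 - 1 = m + 1 := by omega
    have e2 : m + 2 - 2 = m := by omega
    rw [e1, e2, Nat.factorial_succ]
    push_cast
    have hm : (m.factorial : ℝ) ≠ 0 := by positivity
    have hm1 : ((m : ℝ) + 2 - 1) = (m : ℝ) + 1 := by ring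
    rw [hm1]
    field_simp

/-! ### The order average -/

/-- One time class of the random-order average: over the `(n-1)!` orders revealing row `i` at
time `p`, `∑_ρ log (∑_{i' : ρ i ≤ ρ i'} w i') ≤ (n-1)! · log (w i + (1 - w i)(n-1-p)/(n-1))`
(Jensen for `log`; the class average of the available mass is exactly
`w i + (1 - w i)(n-1-p)/(n-1)`). [cite: Radhakrishnan1997, proof of Thm 1] -/
theorem sum_filter_perm_log_avail_le {n : ℕ} (w : Fin n → ℝ) (i p : Fin n)
    (hw0 : ∀ i', 0 ≤ w i') (hw1 : ∑ i', w i' = 1) (hwi : 0 < w i) :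
    ∑ ρ ∈ Finset.univ.filter (fun ρ : Equiv.Perm (Fin n) => ρ i = p),
        Real.log (∑ i' ∈ Finset.univ.filter (fun i' => ρ i ≤ ρ i'), w i') ≤
      ((n - 1).factorial : ℝ) *
        Real.log (w i + (1 - w i) * (((n - 1 - (p : ℕ) : ℕ) : ℝ) / ((n : ℝ) - 1))) := by
  set T := Finset.univ.filter (fun ρ : Equiv.Perm (Fin n) => ρ i = p) with hT
  have hTcard : T.card = (n - 1).factorial := by
    rw [hT, card_filter_perm_apply_eq, Fintype.card_fin]
  have hYpos : ∀ ρ ∈ T, 0 < ∑ i' ∈ Finset.univ.filter (fun i' => ρ i ≤ ρ i'), w i' :=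
    fun ρ _ => lt_of_lt_of_le hwi (Finset.single_le_sum (f := w) (fun i' _ => hw0 i')
      (Finset.mem_filter.2 ⟨Finset.mem_univ _, le_rfl⟩))
  refine (sum_log_le_card_mul_log_div T _ hYpos).trans_eq ?_
  have herase : ∑ i' ∈ Finset.univ.erase i, w i' = 1 - w i := by
    rw [← hw1, ← Finset.add_sum_erase _ _ (Finset.mem_univ i)]
    ring
  have hF : ((n - 1).factorial : ℝ) ≠ 0 := by positivity
  rw [hTcard, hT, sum_filter_perm_apply_eq_sum_avail, herase, add_div, mul_div_cancel_right₀ _ hF,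
    mul_div_assoc, cast_mul_factorial_div_factorial p.is_lt]

/-- **The random-order average** (Radhakrishnan's averaging step, in the form used by
Cuckler–Kahn).  For a probability vector `w` on `Fin n` and a row `i` with `w i > 0`,
`∑_ρ log (∑_{i' : ρ i ≤ ρ i'} w i') ≤ (n-1)! · ∑_{k < n} log (w i + (1 - w i) · k/(n-1))`,
the sum over all `n!` orders `ρ` (row `i'` revealed at time `ρ i'`).
[cite: Radhakrishnan1997, proof of Thm 1] -/
theorem sum_perm_log_avail_le (n : ℕ) (w : Fin n → ℝ) (i : Fin n) (hw0 : ∀ i', 0 ≤ w i')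
    (hw1 : ∑ i', w i' = 1) (hwi : 0 < w i) :
    ∑ ρ : Equiv.Perm (Fin n),
        Real.log (∑ i' ∈ Finset.univ.filter (fun i' => ρ i ≤ ρ i'), w i') ≤
      ((n - 1).factorial : ℝ) *
        ∑ k ∈ Finset.range n, Real.log (w i + (1 - w i) * ((k : ℝ) / ((n : ℝ) - 1))) := by
  calc ∑ ρ : Equiv.Perm (Fin n),
        Real.log (∑ i' ∈ Finset.univ.filter (fun i' => ρ i ≤ ρ i'), w i')
      = ∑ p : Fin n, ∑ ρ ∈ Finset.univ.filter (fun ρ : Equiv.Perm (Fin n) => ρ i = p),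
          Real.log (∑ i' ∈ Finset.univ.filter (fun i' => ρ i ≤ ρ i'), w i') :=
        (Finset.sum_fiberwise _ _ _).symm
    _ ≤ ∑ p : Fin n, ((n - 1).factorial : ℝ) *
          Real.log (w i + (1 - w i) * (((n - 1 - (p : ℕ) : ℕ) : ℝ) / ((n : ℝ) - 1))) :=
        Finset.sum_le_sum fun p _ => sum_filter_perm_log_avail_le w i p hw0 hw1 hwi
    _ = ((n - 1).factorial : ℝ) *
          ∑ k ∈ Finset.range n, Real.log (w i + (1 - w i) * ((k : ℝ) / ((n : ℝ) - 1))) := by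
        rw [Finset.mul_sum, Fin.sum_univ_eq_sum_range (fun k => ((n - 1).factorial : ℝ) *
          Real.log (w i + (1 - w i) * (((n - 1 - k : ℕ) : ℝ) / ((n : ℝ) - 1)))) n,
          Finset.sum_range_reflect (fun k => ((n - 1).factorial : ℝ) *
          Real.log (w i + (1 - w i) * ((k : ℝ) / ((n : ℝ) - 1)))) n]

/-- **The random-order average, `τ = ρ⁻¹` form.**  With orders written as `τ : Fin n ≃ Fin n`,
`τ k` = the row revealed at time `k` (so row `i'` is not revealed before row `i` iff
`τ⁻¹ i ≤ τ⁻¹ i'`): for a probability vector `w` on `Fin n` and a row `i` with `w i > 0`,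
`∑_τ log (∑_{i' : τ⁻¹ i ≤ τ⁻¹ i'} w i') ≤ (n-1)! · ∑_{k < n} log (w i + (1 - w i) · k/(n-1))`.
[cite: Radhakrishnan1997, proof of Thm 1] -/
theorem sum_perm_log_avail_symm_le (n : ℕ) (w : Fin n → ℝ) (i : Fin n) (hw0 : ∀ i', 0 ≤ w i')
    (hw1 : ∑ i', w i' = 1) (hwi : 0 < w i) :
    ∑ τ : Equiv.Perm (Fin n),
        Real.log (∑ i' ∈ Finset.univ.filter (fun i' => τ.symm i ≤ τ.symm i'), w i') ≤
      ((n - 1).factorial : ℝ) *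
        ∑ k ∈ Finset.range n, Real.log (w i + (1 - w i) * ((k : ℝ) / ((n : ℝ) - 1))) :=
  (Equiv.symm_bijective.sum_comp (fun ρ : Equiv.Perm (Fin n) =>
      Real.log (∑ i' ∈ Finset.univ.filter (fun i' => ρ i ≤ ρ i'), w i'))).trans_le
    (sum_perm_log_avail_le n w i hw0 hw1 hwi)

end Literature.Combinatorics.Enumerative
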